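import Literature.NumberTheory.Automorphic.JacquetModule

/-!
# The modulus character of the upper Borel subgroup of `GL₂(F)` (proof of `deltaChar_borel_gl_two`)

This file discharges the named fact `Literature.NumberTheory.Automorphic.deltaChar_borel_gl_two` of
`Literature.NumberTheory.Automorphic.JacquetModule`:
for a non-archimedean local field `F` and the upper Borel subgroup `B ≤ GL₂(F)`
(`Literature.CplxAlg.borelSubgroup (Fin 2) F`), Mathlib's modular character
`MeasureTheory.Measure.modularCharacter : ↥B →* ℝ≥0` (characterised by `map (· * g) μ = Δ(g) • μ`
for a left Haar measure `μ`) is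
`Δ(p) = |p₀₀ / p₁₁|_F`, i.e. `Literature.deltaChar B = δ_B`, the classical modulus of
Bernstein–Zelevinsky (1977, 1.7: `Δ_G` is the module of the inner automorphisms `u ↦ g u g⁻¹`,
`∫ f(g⁻¹ u g) dμ(u) = Δ_G(g) ∫ f(u) dμ(u)`; with `μ` left invariant the left side is
`∫ f d(map (· * g) μ)`, so `Δ_G` is Mathlib's `modularCharacter`).

## Proof

Standard (Bernstein–Zelevinsky 1977, 1.7; the explicit value `δ_B(b) = |y₁/y₂|` for
`b = n · diag(y₁, y₂)`, with `δ_G` defined by `d_R g = δ_G(g) d_L g` — which is Mathlib's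
convention — is printed in Bump 1997, §4.2, (2.2)–(2.3)), via the compact open
subgroup `K = B(𝒪) = {[[a, b], [0, d]] : |a| = |d| = 1, |b| ≤ 1}`:
* for a left Haar measure `μ` and an open set `U`, `μ(U g⁻¹) = Δ(g) μ(U)`, hence
  `Δ(t) μ(U) = μ(t U t⁻¹)`; in particular `Δ = 1` on `K` and on the centre (both normalise `K`),
  and `Δ` is conjugation invariant, so `Δ = 1` on the unipotent radical
  (`u(x) = diag(x, 1) u(1) diag(x, 1)⁻¹` with `u(1) ∈ K`);
* for `t = diag(ϖ, 1)`, `t K t⁻¹ = {|b| ≤ |ϖ|} ≤ K` has index `q = |𝓀_F|` (cosets `u(s κ) t K t⁻¹`,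
  `κ ∈ 𝓀_F`), so `Δ(t) = q⁻¹ = |ϖ|_F`;
* writing `a = u ϖ^{-m}` with `|u| = 1` gives `Δ(diag(a, 1)) = |a|_F`, and
  `[[a, b], [0, d]] = diag(a, 1) · diag(d, d) · diag(d, 1)⁻¹ · u(b / a)`.

The topological input is that `K` is open (the entries are continuous on `↥B ≤ GL₂(F)`, whose
topology is induced from `M₂(F) × M₂(F)ᵐᵒᵖ`) and compact (it is the continuous image of
`{|x| = 1} × 𝒪 × {|x| = 1}`, inversion being continuous on `F \ {0}`).

## Main declarations

* `Literature.deltaChar_borel_gl_two_holds : deltaChar_borel_gl_two F` — the discharge;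
* `Literature.NumberTheory.Automorphic.DeltaCharBorel.modularCharacter_borel_eq` — `Δ(p) = |p₀₀ / p₁₁|_F` in `ℝ≥0`;
* helper API in `namespace Literature.DeltaCharBorel`: coordinates `bElt a d b = [[a, b], [0, d]]` on
  `↥B`, the subgroups `kSub F γ = {|a| = |d| = 1, |b| ≤ γ}`, general lemmas on Mathlib's modular
  character and compact open subgroups (`measure_preimage_mul_right_eq_modularCharacter_mul`,
  `modularCharacter_mul_measure_eq`, `modularCharacter_eq_one_of_mem`,
  `measure_iUnion_smul_subgroup`, `modularCharacter_conj`), and local-field lemmas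
  (`exists_uniformizer`, `normAbs_eq_zpow_log`, `normAbs_uniformizer_eq`).

## References

* I. N. Bernstein, A. V. Zelevinsky, *Induced representations of reductive `p`-adic groups I*,
  Ann. Sci. ÉNS 10 (1977), 441–472, §1.7 (p. 444).
* D. Bump, *Automorphic Forms and Representations*, Cambridge Studies in Advanced Mathematics 55
  (1997), §4.2, (2.1)–(2.3) (the modular quasicharacter `δ_B` of the Borel subgroup of `GL(n, F)`).
-/

open scoped NNReal ENNReal Pointwise WithZero
open MeasureTheory ValuativeRel

namespace Literature.NumberTheory.Automorphic

namespace DeltaCharBorel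

/-! ### Coordinates on the upper Borel subgroup of `GL₂` -/

section Algebra

variable {F : Type*} [Field F]

/-- The invertible upper triangular matrix `[[a, b], [0, d]]` (`a d : Fˣ`, `b : F`) as an element
of `GL₂(F)`, with its inverse `[[a⁻¹, -a⁻¹ b d⁻¹], [0, d⁻¹]]` given explicitly. [folklore] -/
def borelGL (a d : Fˣ) (b : F) : GL (Fin 2) F where
  val := !![(a : F), b; 0, (d : F)]
  inv := !![((a⁻¹ : Fˣ) : F), -(((a⁻¹ : Fˣ) : F) * b * ((d⁻¹ : Fˣ) : F)); 0, ((d⁻¹ : Fˣ) : F)]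
  val_inv := by
    rw [Matrix.mul_fin_two, Matrix.one_fin_two]
    simp [mul_assoc]
  inv_val := by
    rw [Matrix.mul_fin_two, Matrix.one_fin_two]
    simp [mul_assoc]

/-- The underlying matrix of `borelGL a d b` is `[[a, b], [0, d]]`. [folklore] -/
lemma coe_borelGL (a d : Fˣ) (b : F) :
    (borelGL a d b : Matrix (Fin 2) (Fin 2) F) = !![(a : F), b; 0, (d : F)] := rfl

/-- Multiplication of upper triangular matrices:
`[[a, b], [0, d]] [[a', b'], [0, d']] = [[a a', a b' + b d'], [0, d d']]`. [folklore] -/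
lemma borelGL_mul (a d a' d' : Fˣ) (b b' : F) :
    borelGL a d b * borelGL a' d' b' = borelGL (a * a') (d * d') (a * b' + b * d') := by
  apply Units.ext
  rw [Units.val_mul, coe_borelGL, coe_borelGL, coe_borelGL, Matrix.mul_fin_two]
  simp

/-- `[[1, 0], [0, 1]] = 1`. [folklore] -/
lemma borelGL_one : (borelGL 1 1 0 : GL (Fin 2) F) = 1 := by
  apply Units.ext
  rw [Units.val_one, coe_borelGL, Matrix.one_fin_two]
  simp

/-- `[[a, b], [0, d]]` lies in the upper Borel subgroup `Literature.CplxAlg.borelSubgroup (Fin 2) F`.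
[folklore] -/
lemma borelGL_mem (a d : Fˣ) (b : F) : borelGL a d b ∈ DiophantineGeometry.borelSubgroup (Fin 2) F := by
  intro i j hij
  fin_cases i <;> fin_cases j <;> simp at hij
  rfl

/-- `bElt a d b = [[a, b], [0, d]]` as an element of the upper Borel subgroup `B ≤ GL₂(F)`.
[folklore] -/
def bElt (a d : Fˣ) (b : F) : DiophantineGeometry.borelSubgroup (Fin 2) F :=
  ⟨borelGL a d b, borelGL_mem a d b⟩

/-- `bElt a d b` coerces to `borelGL a d b`. [folklore] -/
@[simp] lemma coe_bElt (a d : Fˣ) (b : F) : (bElt a d b : GL (Fin 2) F) = borelGL a d b := rfl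

/-- Multiplication in coordinates: `bElt a d b * bElt a' d' b' = bElt (a a') (d d') (a b' + b d')`.
[folklore] -/
lemma bElt_mul (a d a' d' : Fˣ) (b b' : F) :
    bElt a d b * bElt a' d' b' = bElt (a * a') (d * d') (a * b' + b * d') :=
  Subtype.ext (borelGL_mul a d a' d' b b')

/-- `bElt 1 1 0 = 1`. [folklore] -/
@[simp] lemma bElt_one : (bElt 1 1 0 : DiophantineGeometry.borelSubgroup (Fin 2) F) = 1 :=
  Subtype.ext borelGL_one

/-- Inversion in coordinates: `(bElt a d b)⁻¹ = bElt a⁻¹ d⁻¹ (-a⁻¹ b d⁻¹)`. [folklore] -/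
lemma bElt_inv (a d : Fˣ) (b : F) :
    (bElt a d b)⁻¹ = bElt a⁻¹ d⁻¹ (-(((a⁻¹ : Fˣ) : F) * b * ((d⁻¹ : Fˣ) : F))) := by
  apply inv_eq_of_mul_eq_one_right
  rw [bElt_mul, mul_inv_cancel, mul_inv_cancel, ← bElt_one]
  congr 1
  simp [mul_assoc]

/-- Conjugation by `diag(w, 1)`: `diag(w,1)⁻¹ [[a, b], [0, d]] diag(w, 1) = [[a, w⁻¹ b], [0, d]]`.
[folklore] -/
lemma conj_bElt (w a d : Fˣ) (b : F) :
    (bElt w 1 0)⁻¹ * bElt a d b * bElt w 1 0 = bElt a d (((w⁻¹ : Fˣ) : F) * b) := by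
  rw [bElt_inv, bElt_mul, bElt_mul]
  congr 1 <;> simp

/-- `u(x)⁻¹ u(y) = u(y - x)` for the unipotent elements `u(x) = bElt 1 1 x`. [folklore] -/
lemma bElt_one_one_inv_mul (x y : F) : (bElt 1 1 x)⁻¹ * bElt 1 1 y = bElt 1 1 (y - x) := by
  rw [bElt_inv, bElt_mul]
  congr 1 <;> simp
  ring

variable (F) in
/-- The homomorphism `a ↦ diag(a, 1)`, `Fˣ →* B`. [folklore] -/
def diagHom : Fˣ →* DiophantineGeometry.borelSubgroup (Fin 2) F where
  toFun a := bElt a 1 0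
  map_one' := bElt_one
  map_mul' a b := by
    rw [bElt_mul]
    congr 1 <;> simp

variable (F) in
/-- `diagHom F a = bElt a 1 0 = diag(a, 1)`. [folklore] -/
@[simp] lemma diagHom_apply (a : Fˣ) : diagHom F a = bElt a 1 0 := rfl

variable (p : DiophantineGeometry.borelSubgroup (Fin 2) F)

/-- `ent p i j` is the `(i, j)` entry of an element `p` of the Borel subgroup. [folklore] -/
abbrev ent (i j : Fin 2) : F := ((p : GL (Fin 2) F) : Matrix (Fin 2) (Fin 2) F) i j

/-- The `(1, 0)` entry of an upper triangular matrix vanishes. [folklore] -/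
lemma ent_one_zero : ent p 1 0 = 0 := p.2 (show (0 : Fin 2) < 1 from by decide)

/-- The `(0, 0)` entry of an invertible upper triangular matrix is nonzero. [folklore] -/
lemma ent_zero_zero_ne_zero : ent p 0 0 ≠ 0 := DiophantineGeometry.diag_ne_zero_of_isUpperTriangular p.2 0

/-- The `(1, 1)` entry of an invertible upper triangular matrix is nonzero. [folklore] -/
lemma ent_one_one_ne_zero : ent p 1 1 ≠ 0 := DiophantineGeometry.diag_ne_zero_of_isUpperTriangular p.2 1

/-- Every element of `B` is `[[a, b], [0, d]]` with `a = p₀₀`, `d = p₁₁`, `b = p₀₁`. [folklore] -/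
lemma bElt_eta : bElt (Units.mk0 _ (ent_zero_zero_ne_zero p))
    (Units.mk0 _ (ent_one_one_ne_zero p)) (ent p 0 1) = p := by
  apply Subtype.ext
  apply Matrix.GeneralLinearGroup.ext
  intro i j
  fin_cases i <;> fin_cases j
  · rfl
  · rfl
  · exact (ent_one_zero p).symm
  · rfl

/-- `(bElt a d b)₀₀ = a`. [folklore] -/
@[simp] lemma ent_bElt_zero_zero (a d : Fˣ) (b : F) : ent (bElt a d b) 0 0 = a := rfl

/-- `(bElt a d b)₀₁ = b`. [folklore] -/
@[simp] lemma ent_bElt_zero_one (a d : Fˣ) (b : F) : ent (bElt a d b) 0 1 = b := rfl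

/-- `(bElt a d b)₁₁ = d`. [folklore] -/
@[simp] lemma ent_bElt_one_one (a d : Fˣ) (b : F) : ent (bElt a d b) 1 1 = d := rfl

/-- Every element of `B` is of the form `bElt a d b` (used as `obtain ⟨a, d, b, rfl⟩`).
[folklore] -/
lemma bElt_surjective (p : DiophantineGeometry.borelSubgroup (Fin 2) F) :
    ∃ (a d : Fˣ) (b : F), bElt a d b = p :=
  ⟨_, _, _, bElt_eta p⟩

/-- Scalar matrices `bElt c c 0` are central in `B`. [folklore] -/
lemma bElt_scalar_comm (c : Fˣ) (y : DiophantineGeometry.borelSubgroup (Fin 2) F) :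
    y * bElt c c 0 = bElt c c 0 * y := by
  obtain ⟨a, d, b, rfl⟩ := bElt_surjective y
  rw [bElt_mul, bElt_mul]
  congr 1 <;> simp [mul_comm]

end Algebra

/-! ### Haar measure, compact open subgroups and Mathlib's modular character -/

section Haar

variable {G : Type*} [Group G]

/-- `(· * t)⁻¹' U = U t⁻¹ = t⁻¹ (t U t⁻¹)`, written with preimages. [folklore] -/
lemma preimage_mul_right_eq_preimage_mul_left_conj (U : Set G) (t : G) :
    (· * t) ⁻¹' U = (t * ·) ⁻¹' ((fun y => t⁻¹ * y * t) ⁻¹' U) := by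
  ext x
  simp [mul_assoc]

variable [TopologicalSpace G] [IsTopologicalGroup G] [LocallyCompactSpace G]

/-- The modular character is invariant under conjugation (its codomain `ℝ≥0` is commutative and
its values are nonzero). [folklore] -/
lemma modularCharacter_conj (g k : G) :
    Measure.modularCharacter (g * k * g⁻¹) = Measure.modularCharacter k := by
  have hg : Measure.modularCharacter g ≠ 0 := (Measure.modularCharacterFun_pos g).ne'
  have : Measure.modularCharacter (g * k * g⁻¹) * Measure.modularCharacter g =
      Measure.modularCharacter k * Measure.modularCharacter g := by
    rw [← map_mul, inv_mul_cancel_right, map_mul, mul_comm]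
  exact mul_right_cancel₀ hg this

/-- `Δ(g⁻¹) = Δ(g)⁻¹`. [folklore] -/
lemma modularCharacter_inv (g : G) :
    Measure.modularCharacter g⁻¹ = (Measure.modularCharacter g)⁻¹ :=
  eq_inv_of_mul_eq_one_left (by rw [← map_mul, inv_mul_cancel, map_one])

variable [MeasurableSpace G] [BorelSpace G] (μ : Measure G) [μ.IsHaarMeasure]

/-- For a left Haar measure `μ` and an open set `U`, `μ (U g⁻¹) = Δ(g) μ(U)`, where `Δ` is
Mathlib's modular character (`map (· * g) μ = Δ(g) • μ`; Bernstein–Zelevinsky 1977, 1.7).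
[folklore] -/
lemma measure_preimage_mul_right_eq_modularCharacter_mul {U : Set G} (hU : IsOpen U) (g : G) :
    μ ((· * g) ⁻¹' U) = Measure.modularCharacter g * μ U := by
  have h1 : (Measure.map (· * g) μ) U = (Measure.map (· * g) μ).haarScalarFactor μ • μ U :=
    Measure.measure_isHaarMeasure_eq_smul_of_isOpen _ _ hU
  rw [Measure.map_apply (measurable_mul_const g) hU.measurableSet] at h1
  rw [h1, ← Measure.modularCharacterFun_eq_haarScalarFactor μ g]
  rfl

/-- `Δ(t) μ(U) = μ(t U t⁻¹)` for a left Haar measure `μ` and an open set `U` (here `t U t⁻¹` is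
written as the preimage of `U` under `y ↦ t⁻¹ y t`): the module of the inner automorphism
(Bernstein–Zelevinsky 1977, 1.7). [folklore] -/
lemma modularCharacter_mul_measure_eq {U : Set G} (hU : IsOpen U) (t : G) :
    Measure.modularCharacter t * μ U = μ ((fun y => t⁻¹ * y * t) ⁻¹' U) := by
  rw [← measure_preimage_mul_right_eq_modularCharacter_mul μ hU t,
    preimage_mul_right_eq_preimage_mul_left_conj, measure_preimage_mul]

/-- If `t` normalises an open set `U` of finite positive Haar measure (e.g. a compact open
subgroup), then `Δ(t) = 1`. [folklore] -/
lemma modularCharacter_eq_one_of_conj_preimage_eq {U : Set G} (hU : IsOpen U)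
    (hne : U.Nonempty) (htop : μ U ≠ ∞) {t : G} (ht : (fun y => t⁻¹ * y * t) ⁻¹' U = U) :
    Measure.modularCharacter t = 1 := by
  have h := modularCharacter_mul_measure_eq μ hU t
  rw [ht] at h
  have h0 : μ U ≠ 0 := hU.measure_ne_zero μ hne
  have h' : (Measure.modularCharacter t : ℝ≥0∞) * μ U = 1 * μ U := by rwa [one_mul]
  rw [ENNReal.mul_left_inj h0 htop] at h'
  exact_mod_cast h'

include μ in
/-- An element of a compact open subgroup has modulus `1` ("a positive character of a compact
group is trivial", Bernstein–Zelevinsky 1977, 1.7). [folklore] -/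
lemma modularCharacter_eq_one_of_mem {K : Subgroup G} (hK : IsOpen (K : Set G))
    (hKc : IsCompact (K : Set G)) {k : G} (hk : k ∈ K) : Measure.modularCharacter k = 1 := by
  refine modularCharacter_eq_one_of_conj_preimage_eq μ hK ⟨1, K.one_mem⟩ hKc.measure_lt_top.ne ?_
  ext y
  simp only [Set.mem_preimage, SetLike.mem_coe]
  constructor
  · intro h
    have := K.mul_mem (K.mul_mem hk h) (K.inv_mem hk)
    simpa [mul_assoc] using this
  · intro h
    exact K.mul_mem (K.mul_mem (K.inv_mem hk) h) hk

omit [LocallyCompactSpace G] in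
/-- A finite disjoint union of left cosets `g i • K` of a subgroup `K` has (left Haar) measure
`#ι · μ(K)`. [folklore] -/
lemma measure_iUnion_smul_subgroup {ι : Type*} [Finite ι] (K : Subgroup G)
    (hK : MeasurableSet (K : Set G)) (g : ι → G) (hg : ∀ i j, (g i)⁻¹ * g j ∈ K → i = j) :
    μ (⋃ i, g i • (K : Set G)) = Nat.card ι * μ K := by
  haveI := Fintype.ofFinite ι
  rw [measure_iUnion]
  · simp [measure_smul, tsum_fintype, Nat.card_eq_fintype_card]
  · intro i j hij
    rw [Function.onFun, Set.disjoint_left]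
    rintro x ⟨k, hk, rfl⟩ ⟨k', hk', h⟩
    apply hij
    apply hg
    have h' : g j * k' = g i * k := h
    have : (g i)⁻¹ * g j = k * k'⁻¹ := by
      rw [inv_mul_eq_iff_eq_mul, ← mul_assoc, ← h', mul_inv_cancel_right]
    rw [this]
    exact K.mul_mem hk (K.inv_mem hk')
  · intro i
    exact hK.const_smul (g i)

end Haar

/-! ### Valuative topology: balls and spheres -/

section Valuative

variable {F : Type*} [Field F] [ValuativeRel F] [TopologicalSpace F] [IsValuativeTopology F]

/-- Open balls `{v < γ}` are open in the valuative topology. [folklore] -/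
lemma isOpen_setOf_valuation_lt (γ : ValueGroupWithZero F) :
    IsOpen {x : F | valuation F x < γ} := by
  rw [isOpen_iff_mem_nhds]
  intro x hx
  rcases eq_or_ne γ 0 with rfl | hγ
  · simp at hx
  rw [IsValuativeTopology.mem_nhds_iff']
  refine ⟨Units.mk0 γ hγ, fun z hz => ?_⟩
  simp only [Set.mem_setOf_eq, Units.val_mk0] at hz hx ⊢
  calc valuation F z = valuation F (z - x + x) := by rw [sub_add_cancel]
    _ ≤ max (valuation F (z - x)) (valuation F x) := Valuation.map_add _ _ _
    _ < γ := max_lt hz hx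

/-- Closed balls `{v ≤ γ}`, `γ ≠ 0`, are open in the valuative topology. [folklore] -/
lemma isOpen_setOf_valuation_le {γ : ValueGroupWithZero F} (hγ : γ ≠ 0) :
    IsOpen {x : F | valuation F x ≤ γ} := by
  rw [isOpen_iff_mem_nhds]
  intro x hx
  rw [IsValuativeTopology.mem_nhds_iff']
  refine ⟨Units.mk0 γ hγ, fun z hz => ?_⟩
  simp only [Set.mem_setOf_eq, Units.val_mk0] at hz hx ⊢
  calc valuation F z = valuation F (z - x + x) := by rw [sub_add_cancel]
    _ ≤ max (valuation F (z - x)) (valuation F x) := Valuation.map_add _ _ _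
    _ ≤ γ := max_le hz.le hx

/-- Spheres `{v = γ}`, `γ ≠ 0`, are open in the valuative topology. [folklore] -/
lemma isOpen_setOf_valuation_eq {γ : ValueGroupWithZero F} (hγ : γ ≠ 0) :
    IsOpen {x : F | valuation F x = γ} := by
  rw [isOpen_iff_mem_nhds]
  intro x hx
  rw [IsValuativeTopology.mem_nhds_iff']
  refine ⟨Units.mk0 γ hγ, fun z hz => ?_⟩
  simp only [Set.mem_setOf_eq, Units.val_mk0] at hz hx ⊢
  rw [← hx] at hz ⊢
  exact Valuation.map_eq_of_sub_lt _ hz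

/-- Complements of closed balls `{γ < v}` are open in the valuative topology. [folklore] -/
lemma isOpen_setOf_lt_valuation (γ : ValueGroupWithZero F) :
    IsOpen {x : F | γ < valuation F x} := by
  rw [isOpen_iff_mem_nhds]
  intro x hx
  have hx0 : valuation F x ≠ 0 := ne_zero_of_lt hx
  rw [IsValuativeTopology.mem_nhds_iff']
  refine ⟨Units.mk0 _ hx0, fun z hz => ?_⟩
  simp only [Set.mem_setOf_eq, Units.val_mk0] at hz hx ⊢
  rwa [Valuation.map_eq_of_sub_lt _ hz]

/-- Spheres `{v = γ}` are closed in the valuative topology. [folklore] -/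
lemma isClosed_setOf_valuation_eq (γ : ValueGroupWithZero F) :
    IsClosed {x : F | valuation F x = γ} := by
  rw [← isOpen_compl_iff]
  have : {x : F | valuation F x = γ}ᶜ = {x | valuation F x < γ} ∪ {x | γ < valuation F x} := by
    ext x
    simp only [Set.mem_compl_iff, Set.mem_setOf_eq, Set.mem_union]
    exact lt_or_lt_iff_ne.symm
  rw [this]
  exact (isOpen_setOf_valuation_lt γ).union (isOpen_setOf_lt_valuation γ)

end Valuative

/-! ### Non-archimedean local fields: uniformizers, `|·|_F`, residue classes -/

section LocalField

variable (F : Type*) [Field F] [ValuativeRel F] [TopologicalSpace F] [IsNonarchimedeanLocalField F]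

open WithZero (exp log)

/-- The unit sphere `{v = 1} = 𝒪ˣ` of a non-archimedean local field is compact. [folklore] -/
lemma isCompact_setOf_valuation_eq_one : IsCompact {x : F | valuation F x = 1} :=
  (IsNonarchimedeanLocalField.isCompact_closedBall F 1).of_isClosed_subset
    (isClosed_setOf_valuation_eq 1) (fun _ hx => le_of_eq hx)

/-- There is a uniformizer: an element `ϖ` whose valuation corresponds to `exp (-1) ∈ ℤᵐ⁰` under
Mathlib's `IsNonarchimedeanLocalField.valueGroupWithZeroIsoInt`. [folklore] -/
lemma exists_uniformizer : ∃ ϖ : F,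
    IsNonarchimedeanLocalField.valueGroupWithZeroIsoInt F (valuation F ϖ) = exp (-1 : ℤ) := by
  obtain ⟨ϖ, h⟩ := ValuativeRel.valuation_surjective
    ((IsNonarchimedeanLocalField.valueGroupWithZeroIsoInt F).symm (exp (-1 : ℤ)))
  exact ⟨ϖ, by rw [h]; simp⟩

variable {F}

/-- `toAdd (unzero y) = log y` for `y ≠ 0` in `ℤᵐ⁰`. [folklore] -/
lemma toAdd_unzero {y : ℤᵐ⁰} (hy : y ≠ 0) : (WithZero.unzero hy).toAdd = log y := by
  lift y to ℤ using hy
  rfl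

/-- A nonzero element has nonzero image in `ℤᵐ⁰`. [folklore] -/
lemma valueGroupWithZeroIsoInt_ne_zero {x : F} (hx : x ≠ 0) :
    IsNonarchimedeanLocalField.valueGroupWithZeroIsoInt F (valuation F x) ≠ 0 := by
  intro h
  rw [← map_zero (IsNonarchimedeanLocalField.valueGroupWithZeroIsoInt F)] at h
  exact hx ((map_eq_zero (valuation F)).mp
    ((IsNonarchimedeanLocalField.valueGroupWithZeroIsoInt F).injective h))

open GaloisRepresentations.IsNonarchimedeanLocalField in
/-- `|x|_F = q_F ^ log (ψ (v x))` for `x ≠ 0`, unfolding `Literature.NumberTheory.GaloisRepresentations.IsNonarchimedeanLocalField.normAbs`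
(`ψ = valueGroupWithZeroIsoInt`, so `log (ψ (v x)) = -ord(x)`). [folklore] -/
lemma normAbs_eq_zpow_log {x : F} (hx : x ≠ 0) :
    normAbs F x = (residueFieldCard F : ℝ≥0) ^
      log (_root_.IsNonarchimedeanLocalField.valueGroupWithZeroIsoInt F (valuation F x)) := by
  rw [normAbs_apply, WithZeroMulInt.toNNReal_neg_apply _ (valueGroupWithZeroIsoInt_ne_zero hx),
    toAdd_unzero]

open GaloisRepresentations.IsNonarchimedeanLocalField in
/-- Units have normalised absolute value `1`. [folklore] -/
lemma normAbs_eq_one_of_valuation_eq_one {x : F} (hx : valuation F x = 1) : normAbs F x = 1 := by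
  have hx0 : x ≠ 0 := by rintro rfl; simp at hx
  rw [normAbs_eq_zpow_log hx0, hx, map_one, WithZero.log_one, zpow_zero]

/-- Two integers have the same residue class iff their difference has valuation `< 1`.
[folklore] -/
lemma residue_eq_residue_iff (x y : 𝒪[F]) :
    IsLocalRing.residue 𝒪[F] x = IsLocalRing.residue 𝒪[F] y ↔ valuation F ((x : F) - y) < 1 := by
  rw [← sub_eq_zero, ← map_sub, IsLocalRing.residue_eq_zero_iff, IsLocalRing.mem_maximalIdeal,
    mem_nonunits_iff, Valuation.Integer.not_isUnit_iff_valuation_lt_one]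
  rfl

variable {ϖ : F}
  (hϖ : IsNonarchimedeanLocalField.valueGroupWithZeroIsoInt F (valuation F ϖ) = exp (-1 : ℤ))
include hϖ

/-- A uniformizer has nonzero valuation. [folklore] -/
lemma valuation_uniformizer_ne_zero : valuation F ϖ ≠ 0 := by
  intro h
  rw [h, map_zero] at hϖ
  exact WithZero.exp_ne_zero hϖ.symm

/-- A uniformizer is nonzero. [folklore] -/
lemma uniformizer_ne_zero : ϖ ≠ 0 := by
  intro h
  exact valuation_uniformizer_ne_zero hϖ (by rw [h, map_zero])

/-- A uniformizer has valuation `< 1`. [folklore] -/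
lemma valuation_uniformizer_lt_one : valuation F ϖ < 1 := by
  rw [← map_lt_map_iff (IsNonarchimedeanLocalField.valueGroupWithZeroIsoInt F), hϖ, map_one,
    ← WithZero.exp_zero, WithZero.exp_lt_exp]
  decide

/-- The maximal ideal is generated by a uniformizer: `v x < 1 ↔ v x ≤ v ϖ`. [folklore] -/
lemma valuation_lt_one_iff (x : F) : valuation F x < 1 ↔ valuation F x ≤ valuation F ϖ := by
  rw [← map_lt_map_iff (IsNonarchimedeanLocalField.valueGroupWithZeroIsoInt F),
    ← map_le_map_iff (IsNonarchimedeanLocalField.valueGroupWithZeroIsoInt F), hϖ, map_one]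
  rw [show (1 : ℤᵐ⁰) = exp (-1 : ℤ) * exp 1 by rw [← WithZero.exp_add]; simp,
    WithZero.lt_mul_exp_iff_le WithZero.exp_ne_zero]

open GaloisRepresentations.IsNonarchimedeanLocalField in
/-- `|ϖ|_F = q_F⁻¹` (Tate, Corvallis 1979, (1.4.1)); cf. the named fact
`Literature.NumberTheory.GaloisRepresentations.IsNonarchimedeanLocalField.normAbs_uniformizer`, here for uniformizers in the sense of
`exists_uniformizer`. [folklore] -/
lemma normAbs_uniformizer_eq : normAbs F ϖ = (residueFieldCard F : ℝ≥0)⁻¹ := by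
  rw [normAbs_eq_zpow_log (uniformizer_ne_zero hϖ), hϖ, WithZero.log_exp, zpow_neg_one]

/-- `x ϖ^{log ψ(v x)}` is a unit: every `x ≠ 0` is `u ϖ^n` with `v u = 1`. [folklore] -/
lemma valuation_mul_uniformizer_zpow_log {x : F} (hx : x ≠ 0) :
    valuation F (x * ϖ ^ log (IsNonarchimedeanLocalField.valueGroupWithZeroIsoInt F
      (valuation F x))) = 1 := by
  set ψ := IsNonarchimedeanLocalField.valueGroupWithZeroIsoInt F
  have hx' : ψ (valuation F x) ≠ 0 := valueGroupWithZeroIsoInt_ne_zero hx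
  refine (EmbeddingLike.apply_eq_iff_eq ψ).mp ?_
  rw [map_mul, map_zpow₀, map_mul, map_zpow₀, hϖ, map_one, ← WithZero.exp_zsmul, smul_neg,
    zsmul_one, WithZero.exp_neg]
  conv_lhs => rw [← WithZero.exp_log hx']
  simp

end LocalField

/-! ### The compact open subgroups `K_γ` of `B` -/

section Subgroups

variable (F : Type*) [Field F] [ValuativeRel F]

/-- The subgroups `K_γ = {[[a, b], [0, d]] : v a = v d = 1, v b ≤ γ}` of the upper Borel subgroup
of `GL₂(F)`; `K_1 = B(𝒪)` and `K_{v ϖ} = diag(ϖ, 1) K_1 diag(ϖ, 1)⁻¹`. [folklore] -/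
def kSub (γ : ValueGroupWithZero F) : Subgroup (DiophantineGeometry.borelSubgroup (Fin 2) F) where
  carrier := {p | valuation F (ent p 0 0) = 1 ∧ valuation F (ent p 1 1) = 1 ∧
    valuation F (ent p 0 1) ≤ γ}
  one_mem' := by
    refine ⟨?_, ?_, ?_⟩ <;> simp [ent]
  mul_mem' := by
    rintro p q ⟨hp0, hp1, hp2⟩ ⟨hq0, hq1, hq2⟩
    obtain ⟨a, d, b, rfl⟩ := bElt_surjective p
    obtain ⟨a', d', b', rfl⟩ := bElt_surjective q
    simp only [ent_bElt_zero_zero, ent_bElt_zero_one, ent_bElt_one_one] at hp0 hp1 hp2 hq0 hq1 hq2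
    rw [bElt_mul]
    simp only [ent_bElt_zero_zero, ent_bElt_zero_one, ent_bElt_one_one, Set.mem_setOf_eq,
      Units.val_mul, map_mul, hp0, hq0, hp1, hq1, mul_one, true_and]
    calc valuation F (a * b' + b * d')
        ≤ max (valuation F (a * b')) (valuation F (b * d')) := Valuation.map_add _ _ _
      _ ≤ γ := by rw [map_mul, map_mul, hp0, hq1, one_mul, mul_one]; exact max_le hq2 hp2
  inv_mem' := by
    rintro p ⟨hp0, hp1, hp2⟩
    obtain ⟨a, d, b, rfl⟩ := bElt_surjective p
    simp only [ent_bElt_zero_zero, ent_bElt_zero_one, ent_bElt_one_one] at hp0 hp1 hp2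
    rw [bElt_inv]
    simp only [ent_bElt_zero_zero, ent_bElt_zero_one, ent_bElt_one_one, Set.mem_setOf_eq,
      Units.val_inv_eq_inv_val, map_inv₀, hp0, hp1, inv_one, Valuation.map_neg, map_mul, one_mul,
      mul_one, true_and]
    exact hp2

variable {F}

/-- Membership in `K_γ`. [folklore] -/
lemma mem_kSub_iff {γ : ValueGroupWithZero F} (p : DiophantineGeometry.borelSubgroup (Fin 2) F) :
    p ∈ kSub F γ ↔ valuation F (ent p 0 0) = 1 ∧ valuation F (ent p 1 1) = 1 ∧
      valuation F (ent p 0 1) ≤ γ :=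
  Iff.rfl

/-- Membership in `K_γ`, in coordinates. [folklore] -/
lemma bElt_mem_kSub_iff {γ : ValueGroupWithZero F} (a d : Fˣ) (b : F) :
    bElt a d b ∈ kSub F γ ↔ valuation F a = 1 ∧ valuation F d = 1 ∧ valuation F b ≤ γ :=
  Iff.rfl

/-- `K_γ` is monotone in `γ`. [folklore] -/
lemma kSub_mono {γ γ' : ValueGroupWithZero F} (h : γ ≤ γ') : kSub F γ ≤ kSub F γ' :=
  fun _ ⟨h0, h1, h2⟩ => ⟨h0, h1, h2.trans h⟩

/-- `u(x) = bElt 1 1 x ∈ K_γ ↔ v x ≤ γ`. [folklore] -/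
lemma bElt_one_one_mem_kSub_iff {γ : ValueGroupWithZero F} (x : F) :
    bElt 1 1 x ∈ kSub F γ ↔ valuation F x ≤ γ := by
  simp [bElt_mem_kSub_iff]

/-- An element of valuation `1` is nonzero. [folklore] -/
lemma ne_zero_of_valuation_eq_one {x : F} (h : valuation F x = 1) : x ≠ 0 := by
  rintro rfl
  simp at h

variable (F) in
/-- The parameter space `{v = 1} × 𝒪 × {v = 1}` of `K_1 = B(𝒪)` (compact for a local field).
[folklore] -/
abbrev ParamSpace : Type _ := {x : F // valuation F x = 1} × 𝒪[F] × {x : F // valuation F x = 1}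

/-- Parametrisation of `K_1 = B(𝒪)` by `{v = 1} × 𝒪 × {v = 1}`. [folklore] -/
def paramK (s : ParamSpace F) : DiophantineGeometry.borelSubgroup (Fin 2) F :=
  bElt (Units.mk0 s.1.1 (ne_zero_of_valuation_eq_one s.1.2))
    (Units.mk0 s.2.2.1 (ne_zero_of_valuation_eq_one s.2.2.2)) s.2.1

/-- The image of `paramK` is `K_1`. [folklore] -/
lemma range_paramK :
    Set.range (paramK (F := F)) = (kSub F 1 : Set (DiophantineGeometry.borelSubgroup (Fin 2) F)) := by
  ext p
  constructor
  · rintro ⟨s, rfl⟩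
    exact ⟨s.1.2, s.2.2.2, s.2.1.2⟩
  · intro hp
    obtain ⟨a, d, b, rfl⟩ := bElt_surjective p
    obtain ⟨ha, hd, hb⟩ := (bElt_mem_kSub_iff a d b).mp hp
    exact ⟨⟨⟨a, ha⟩, ⟨b, hb⟩, ⟨d, hd⟩⟩, by simp [paramK]⟩

end Subgroups

/-! ### Cosets of `K_{v ϖ}` in `K_1` -/

section Cosets

variable {F : Type*} [Field F] [ValuativeRel F] [TopologicalSpace F] [IsNonarchimedeanLocalField F]

open WithZero (exp log)

variable {ϖ : F}
  (hϖ : IsNonarchimedeanLocalField.valueGroupWithZeroIsoInt F (valuation F ϖ) = exp (-1 : ℤ))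
include hϖ

/-- Conjugating `K_1` by `t = diag(ϖ, 1)` gives `t K_1 t⁻¹ = K_{v ϖ}` (as the preimage of `K_1`
under `y ↦ t⁻¹ y t`). [folklore] -/
lemma conj_preimage_kSub_one :
    (fun y => (bElt (Units.mk0 ϖ (uniformizer_ne_zero hϖ)) 1 0)⁻¹ * y *
        bElt (Units.mk0 ϖ (uniformizer_ne_zero hϖ)) 1 0) ⁻¹'
      (kSub F 1 : Set (DiophantineGeometry.borelSubgroup (Fin 2) F)) = kSub F (valuation F ϖ) := by
  ext p
  obtain ⟨a, d, b, rfl⟩ := bElt_surjective p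
  simp only [Set.mem_preimage, conj_bElt, SetLike.mem_coe, bElt_mem_kSub_iff, map_mul,
    Units.val_inv_eq_inv_val, Units.val_mk0, map_inv₀]
  rw [inv_mul_le_iff₀ (zero_lt_iff.mpr (valuation_uniformizer_ne_zero hϖ)), mul_one]

/-- `K_1` is the union of the cosets `u(s κ) K_{v ϖ}` over the residue field `𝓀_F`, for any
section `s` of the residue map (`[K_1 : K_{v ϖ}] = q_F`). [folklore] -/
lemma kSub_one_eq_iUnion (s : 𝓀[F] → 𝒪[F]) (hs : ∀ κ, IsLocalRing.residue _ (s κ) = κ) :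
    (kSub F 1 : Set (DiophantineGeometry.borelSubgroup (Fin 2) F)) =
      ⋃ κ, bElt 1 1 ((s κ : F)) •
        (kSub F (valuation F ϖ) : Set (DiophantineGeometry.borelSubgroup (Fin 2) F)) := by
  ext p
  simp only [Set.mem_iUnion, Set.mem_smul_set, SetLike.mem_coe, smul_eq_mul]
  constructor
  · intro hp
    obtain ⟨a, d, b, rfl⟩ := bElt_surjective p
    obtain ⟨ha, hd, hb⟩ := (bElt_mem_kSub_iff a d b).mp hp
    have hc : b * ((d⁻¹ : Fˣ) : F) ∈ 𝒪[F] := by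
      rw [Valuation.mem_integer_iff, map_mul, Units.val_inv_eq_inv_val, map_inv₀, hd, inv_one,
        mul_one]
      exact hb
    refine ⟨IsLocalRing.residue _ ⟨_, hc⟩,
      (bElt 1 1 (s (IsLocalRing.residue _ ⟨_, hc⟩) : F))⁻¹ * bElt a d b, ?_,
      by rw [mul_inv_cancel_left]⟩
    rw [bElt_inv, bElt_mul, bElt_mem_kSub_iff]
    refine ⟨by simpa using ha, by simpa using hd, ?_⟩
    rw [← valuation_lt_one_iff hϖ]
    have h1 := (residue_eq_residue_iff _ _).mp (hs (IsLocalRing.residue _ ⟨_, hc⟩))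
    simp only at h1
    have h2 : ((1⁻¹ : Fˣ) : F) * b +
        -(((1⁻¹ : Fˣ) : F) * (s (IsLocalRing.residue _ ⟨_, hc⟩) : F) * ((1⁻¹ : Fˣ) : F)) * d =
        -(d * ((s (IsLocalRing.residue _ ⟨_, hc⟩) : F) - b * ((d⁻¹ : Fˣ) : F))) := by
      simp only [inv_one, Units.val_one, one_mul, mul_one]
      rw [mul_sub, mul_comm (d : F) (b * _), Units.inv_mul_cancel_right]
      ring
    rw [h2, Valuation.map_neg, map_mul, hd, one_mul]
    exact h1
  · rintro ⟨κ, q, hq, rfl⟩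
    refine (kSub F 1).mul_mem ((bElt_one_one_mem_kSub_iff _).mpr (s κ).2) ?_
    exact kSub_mono (valuation_uniformizer_lt_one hϖ).le hq

/-- The cosets `u(s κ) K_{v ϖ}`, `κ ∈ 𝓀_F`, are pairwise distinct. [folklore] -/
lemma residue_transversal_inj (s : 𝓀[F] → 𝒪[F]) (hs : ∀ κ, IsLocalRing.residue _ (s κ) = κ)
    (i j : 𝓀[F]) (h : (bElt 1 1 (s i : F))⁻¹ * bElt 1 1 (s j : F) ∈ kSub F (valuation F ϖ)) :
    i = j := by
  rw [bElt_one_one_inv_mul, bElt_one_one_mem_kSub_iff, ← valuation_lt_one_iff hϖ] at h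
  rw [← hs i, ← hs j]
  exact ((residue_eq_residue_iff _ _).mpr h).symm

end Cosets

/-! ### Topology of `B`: `K_γ` is open, `K_1` is compact -/

section Topology

variable {F : Type*} [Field F] [TopologicalSpace F]

/-- The entries are continuous functions on `↥B ≤ GL₂(F)` (topology of `GL₂(F)` induced from
`M₂(F) × M₂(F)ᵐᵒᵖ`). [folklore] -/
lemma continuous_ent (i j : Fin 2) :
    Continuous (fun p : DiophantineGeometry.borelSubgroup (Fin 2) F => ent p i j) :=
  (Units.continuous_val.comp continuous_subtype_val).matrix_elem i j

variable [ValuativeRel F]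

section Open

variable [IsValuativeTopology F]

/-- `K_γ` is open in `B` for `γ ≠ 0`. [folklore] -/
lemma isOpen_kSub {γ : ValueGroupWithZero F} (hγ : γ ≠ 0) :
    IsOpen (kSub F γ : Set (DiophantineGeometry.borelSubgroup (Fin 2) F)) := by
  have : (kSub F γ : Set (DiophantineGeometry.borelSubgroup (Fin 2) F)) =
      (fun p => ent p 0 0) ⁻¹' {x | valuation F x = 1} ∩
        ((fun p => ent p 1 1) ⁻¹' {x | valuation F x = 1} ∩
          (fun p => ent p 0 1) ⁻¹' {x | valuation F x ≤ γ}) := rfl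
  rw [this]
  exact ((isOpen_setOf_valuation_eq one_ne_zero).preimage (continuous_ent 0 0)).inter
    (((isOpen_setOf_valuation_eq one_ne_zero).preimage (continuous_ent 1 1)).inter
      ((isOpen_setOf_valuation_le hγ).preimage (continuous_ent 0 1)))

end Open

section Compact

variable [IsNonarchimedeanLocalField F]

/-- `paramK` is continuous (inversion is continuous on `F ∖ {0}`; a map into `GL₂(F)` is
continuous iff the matrix and its inverse depend continuously, `Units.continuous_iff`).
[folklore] -/
lemma continuous_paramK : Continuous (paramK (F := F)) := by
  have h1 : Continuous fun s : ParamSpace F => (s.1 : F) :=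
    continuous_subtype_val.comp continuous_fst
  have h2 : Continuous fun s : ParamSpace F => (s.2.1 : F) :=
    continuous_subtype_val.comp (continuous_fst.comp continuous_snd)
  have h3 : Continuous fun s : ParamSpace F => (s.2.2 : F) :=
    continuous_subtype_val.comp (continuous_snd.comp continuous_snd)
  have h1' : Continuous fun s : ParamSpace F => (s.1 : F)⁻¹ :=
    h1.inv₀ fun s => ne_zero_of_valuation_eq_one s.1.2
  have h3' : Continuous fun s : ParamSpace F => (s.2.2 : F)⁻¹ :=
    h3.inv₀ fun s => ne_zero_of_valuation_eq_one s.2.2.2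
  have h4 : Continuous fun s : ParamSpace F => -((s.1 : F)⁻¹ * (s.2.1 : F) * (s.2.2 : F)⁻¹) :=
    Continuous.neg (Continuous.mul (Continuous.mul h1' h2) h3')
  apply Continuous.subtype_mk
  rw [Units.continuous_iff]
  constructor
  · refine continuous_matrix fun i j => ?_
    fin_cases i <;> fin_cases j
    · simpa [borelGL] using h1
    · simpa [borelGL] using h2
    · simpa [borelGL] using continuous_const
    · simpa [borelGL] using h3
  · refine continuous_matrix fun i j => ?_
    fin_cases i <;> fin_cases j
    · simpa [borelGL] using h1'
    · simpa [borelGL] using h4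
    · simpa [borelGL] using continuous_const
    · simpa [borelGL] using h3'

/-- `K_1 = B(𝒪)` is compact (the continuous image of the compact space `{v = 1} × 𝒪 × {v = 1}`).
[folklore] -/
lemma isCompact_kSub_one : IsCompact (kSub F 1 : Set (DiophantineGeometry.borelSubgroup (Fin 2) F)) := by
  haveI : CompactSpace {x : F // valuation F x = 1} :=
    isCompact_iff_compactSpace.mp (isCompact_setOf_valuation_eq_one F)
  rw [← range_paramK]
  exact isCompact_range continuous_paramK

end Compact

end Topology

/-! ### The computation of `Δ_B` -/

section Main

variable (F : Type*) [Field F] [ValuativeRel F] [TopologicalSpace F] [IsNonarchimedeanLocalField F]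
  [LocallyCompactSpace (DiophantineGeometry.borelSubgroup (Fin 2) F)]

open WithZero (exp log)
open GaloisRepresentations.IsNonarchimedeanLocalField (normAbs residueFieldCard)

/-- `Δ = 1` on the compact open subgroup `K_1 = B(𝒪)`. [folklore] -/
lemma modularCharacter_eq_one_of_mem_kSub_one {k : DiophantineGeometry.borelSubgroup (Fin 2) F}
    (hk : k ∈ kSub F 1) : Measure.modularCharacter k = 1 := by
  borelize ↥(DiophantineGeometry.borelSubgroup (Fin 2) F)
  exact modularCharacter_eq_one_of_mem Measure.haar (isOpen_kSub one_ne_zero)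
    isCompact_kSub_one hk

/-- `Δ = 1` on the centre (scalar matrices normalise `K_1`). [folklore] -/
lemma modularCharacter_bElt_scalar (c : Fˣ) :
    Measure.modularCharacter (bElt c c 0 : DiophantineGeometry.borelSubgroup (Fin 2) F) = 1 := by
  borelize ↥(DiophantineGeometry.borelSubgroup (Fin 2) F)
  refine modularCharacter_eq_one_of_conj_preimage_eq Measure.haar (isOpen_kSub one_ne_zero)
    ⟨1, (kSub F 1).one_mem⟩ (isCompact_kSub_one (F := F)).measure_lt_top.ne ?_
  have hc : ∀ y : DiophantineGeometry.borelSubgroup (Fin 2) F, (bElt c c 0)⁻¹ * y * bElt c c 0 = y := by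
    intro y
    rw [mul_assoc, bElt_scalar_comm, inv_mul_cancel_left]
  ext y
  simp [hc]

/-- `Δ = 1` on the unipotent radical: `u(x)` is conjugate by `diag(x, 1)` to `u(1) ∈ K_1`, and `Δ`
is conjugation invariant. [folklore] -/
lemma modularCharacter_bElt_unipotent (x : F) :
    Measure.modularCharacter (bElt 1 1 x : DiophantineGeometry.borelSubgroup (Fin 2) F) = 1 := by
  rcases eq_or_ne x 0 with rfl | hx
  · rw [bElt_one, map_one]
  · have h : (bElt 1 1 x : DiophantineGeometry.borelSubgroup (Fin 2) F) =
        bElt (Units.mk0 x hx) 1 0 * bElt 1 1 1 * (bElt (Units.mk0 x hx) 1 0)⁻¹ := by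
      rw [bElt_mul, bElt_inv, bElt_mul]
      congr 1 <;> simp
    rw [h, modularCharacter_conj]
    exact modularCharacter_eq_one_of_mem_kSub_one F
      ((bElt_one_one_mem_kSub_iff 1).mpr (le_of_eq (map_one _)))

variable {F} in
/-- `Δ(diag(ϖ, 1)) = q_F⁻¹`: `Δ(t) μ(K_1) = μ(t K_1 t⁻¹) = μ(K_{v ϖ})` and
`μ(K_1) = [K_1 : K_{v ϖ}] μ(K_{v ϖ}) = q_F μ(K_{v ϖ})`. [folklore] -/
lemma modularCharacter_bElt_uniformizer {ϖ : F}
    (hϖ : IsNonarchimedeanLocalField.valueGroupWithZeroIsoInt F (valuation F ϖ) = exp (-1 : ℤ)) :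
    Measure.modularCharacter (bElt (Units.mk0 ϖ (uniformizer_ne_zero hϖ)) 1 0 :
      DiophantineGeometry.borelSubgroup (Fin 2) F) = (residueFieldCard F : ℝ≥0)⁻¹ := by
  borelize ↥(DiophantineGeometry.borelSubgroup (Fin 2) F)
  set μ : Measure (DiophantineGeometry.borelSubgroup (Fin 2) F) := Measure.haar
  set t : DiophantineGeometry.borelSubgroup (Fin 2) F := bElt (Units.mk0 ϖ (uniformizer_ne_zero hϖ)) 1 0
    with ht
  have h1 : (Measure.modularCharacter t : ℝ≥0∞) * μ (kSub F 1) = μ (kSub F (valuation F ϖ)) := by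
    rw [modularCharacter_mul_measure_eq μ (isOpen_kSub one_ne_zero) t, ht,
      conj_preimage_kSub_one hϖ]
  obtain ⟨s, hs⟩ : ∃ s : 𝓀[F] → 𝒪[F], ∀ κ, IsLocalRing.residue _ (s κ) = κ :=
    ⟨Function.surjInv IsLocalRing.residue_surjective,
      Function.surjInv_eq IsLocalRing.residue_surjective⟩
  have h2 : μ (kSub F 1) = (residueFieldCard F : ℝ≥0∞) * μ (kSub F (valuation F ϖ)) := by
    rw [kSub_one_eq_iUnion hϖ s hs, measure_iUnion_smul_subgroup μ (kSub F (valuation F ϖ))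
      (isOpen_kSub (valuation_uniformizer_ne_zero hϖ)).measurableSet _
      (residue_transversal_inj hϖ s hs)]
    rfl
  have h0 : μ (kSub F (valuation F ϖ)) ≠ 0 :=
    (isOpen_kSub (valuation_uniformizer_ne_zero hϖ)).measure_ne_zero μ ⟨1, Subgroup.one_mem _⟩
  have htop : μ (kSub F (valuation F ϖ)) ≠ ∞ :=
    ((measure_mono (SetLike.coe_subset_coe.mpr
      (kSub_mono (valuation_uniformizer_lt_one hϖ).le))).trans_lt
        (isCompact_kSub_one (F := F)).measure_lt_top).ne
  rw [h2, ← mul_assoc] at h1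
  have h3 : (Measure.modularCharacter t : ℝ≥0∞) * (residueFieldCard F : ℝ≥0∞) = 1 := by
    rw [← ENNReal.mul_left_inj h0 htop, h1, one_mul]
  have h4 : Measure.modularCharacter t * (residueFieldCard F : ℝ≥0) = 1 := by exact_mod_cast h3
  exact eq_inv_of_mul_eq_one_left h4

/-- `Δ(diag(a, 1)) = |a|_F`: both sides are homomorphisms `Fˣ → ℝ≥0` that are `1` on units
(`diag(u, 1) ∈ K_1`) and `q_F⁻¹` at `ϖ`, and `a = u ϖ^n`. [folklore] -/
lemma modularCharacter_diag_eq_normAbs (a : Fˣ) :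
    Measure.modularCharacter (bElt a 1 0 : DiophantineGeometry.borelSubgroup (Fin 2) F) = normAbs F a := by
  obtain ⟨ϖ, hϖ⟩ := exists_uniformizer F
  set ψ := IsNonarchimedeanLocalField.valueGroupWithZeroIsoInt F
  let f : Fˣ →* ℝ≥0 := (Measure.modularCharacter).comp (diagHom F)
  have hf1 : ∀ u : Fˣ, valuation F u = 1 → f u = 1 := fun u hu =>
    modularCharacter_eq_one_of_mem_kSub_one F
      ((bElt_mem_kSub_iff u 1 0).mpr ⟨hu, map_one _, by simp⟩)
  have hfϖ : f (Units.mk0 ϖ (uniformizer_ne_zero hϖ)) = (residueFieldCard F : ℝ≥0)⁻¹ :=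
    modularCharacter_bElt_uniformizer hϖ
  have hfinv : ∀ x : Fˣ, f x⁻¹ = (f x)⁻¹ := fun x =>
    eq_inv_of_mul_eq_one_left (by rw [← map_mul, inv_mul_cancel, map_one])
  set m : ℤ := log (ψ (valuation F a))
  set w : Fˣ := Units.mk0 ϖ (uniformizer_ne_zero hϖ)
  have hu : valuation F ((a * w ^ m : Fˣ) : F) = 1 := by
    push_cast
    exact valuation_mul_uniformizer_zpow_log hϖ a.ne_zero
  calc Measure.modularCharacter (bElt a 1 0) = f a := rfl
    _ = f (a * w ^ m * w ^ (-m)) := by rw [zpow_neg, mul_inv_cancel_right]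
    _ = (residueFieldCard F : ℝ≥0) ^ m := by
      rw [map_mul, map_zpow' f hfinv, hf1 _ hu, hfϖ, one_mul, inv_zpow', neg_neg]
    _ = normAbs F a := (normAbs_eq_zpow_log a.ne_zero).symm

/-- **`Δ_B(p) = |p₀₀ / p₁₁|_F`** on the upper Borel subgroup of `GL₂(F)` (Mathlib's modular
character; Bernstein–Zelevinsky 1977, 1.7; Bump 1997, §4.2, (2.2)–(2.3)), via
`[[a, b], [0, d]] = diag(a, 1) · diag(d, d) · diag(d, 1)⁻¹ · u(b / a)`.
[cite: BernsteinZelevinsky1977, 1.7] [cite: Bump1997, §4.2 (2.2)–(2.3)] -/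
theorem modularCharacter_borel_eq (p : DiophantineGeometry.borelSubgroup (Fin 2) F) :
    Measure.modularCharacter p = normAbs F (ent p 0 0 / ent p 1 1) := by
  obtain ⟨a, d, b, rfl⟩ := bElt_surjective p
  simp only [ent_bElt_zero_zero, ent_bElt_one_one]
  have hdecomp : bElt a d b =
      bElt a 1 0 * bElt d d 0 * (bElt d 1 0)⁻¹ * bElt 1 1 (((a⁻¹ : Fˣ) : F) * b) := by
    rw [bElt_inv, bElt_mul, bElt_mul, bElt_mul]
    congr 1 <;> simp
  rw [hdecomp, map_mul, map_mul, map_mul, modularCharacter_diag_eq_normAbs,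
    modularCharacter_bElt_scalar, modularCharacter_inv, modularCharacter_diag_eq_normAbs,
    modularCharacter_bElt_unipotent, map_div₀, mul_one, mul_one, div_eq_mul_inv]

end Main

end DeltaCharBorel

/-- **Discharge of `Literature.NumberTheory.Automorphic.deltaChar_borel_gl_two`** (convention check, outline D4): on the upper
Borel subgroup `B` of `GL₂(F)`, `F` a non-archimedean local field, `Literature.deltaChar B` (Mathlib's
modular character, `map (· * g) μ = Δ(g) • μ`) is `p ↦ |p₀₀ / p₁₁|_F`, the classical `δ_B`
(Bernstein–Zelevinsky 1977, 1.7: `Δ_G` is the module of the inner automorphisms,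
`∫ f(g⁻¹ u g) dμ(u) = Δ_G(g) ∫ f dμ`; Bump 1997, §4.2, (2.2): `δ_B(b) = |y₁ / y₂|` for
`b = n · diag(y₁, y₂)`, where `d_R b = δ_B(b) d_L b`, (2.3)). See
`Literature.NumberTheory.Automorphic.DeltaCharBorel.modularCharacter_borel_eq` for the proof (compact open subgroup `B(𝒪)`,
index `[B(𝒪) : diag(ϖ,1) B(𝒪) diag(ϖ,1)⁻¹] = q_F`, `|ϖ|_F = q_F⁻¹`).
[cite: BernsteinZelevinsky1977, 1.7] [cite: Bump1997, §4.2 (2.2)–(2.3)] -/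
theorem deltaChar_borel_gl_two_holds (F : Type*) [Field F] [ValuativeRel F] [TopologicalSpace F]
    [IsNonarchimedeanLocalField F] : deltaChar_borel_gl_two F := by
  intro _ p
  rw [deltaChar_apply, DeltaCharBorel.modularCharacter_borel_eq]

end Literature.NumberTheory.Automorphic
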